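import Summits.HodgeConjecture.HodgeConjecture.Theorems.WeilTypeLadderAnchorsOnPath
import Summits.HodgeConjecture.HodgeConjecture.Theorems.WeilTypeLadderVariationalOnPath
import HarnessLib

/-!
# WeilTypeLadder · the CM-field decomposition is EXACT: `R3 ⟺ R3anc ∧ R3var|_{e>2}`

b2b cell `hweil` (packet `run/shared/lean/b2b/hodge-weil/`). Prover 2, generation 2 (variational). Companion of
`Theorems/WeilTypeLadderQuadraticVariationalIff.lean` (`R∞ ⟺ R∞anc ∧ R∞var`). Gen 1 landed the glue `R3anc → R3var → R3`
(`weilClassesCMField_of_anchored_of_variational`) and `R3 → R3var` for `e > 2` (`…_of_weilClassesCMField_of_lt`). Since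
R3var (`WeilVariationalHodgeCMField`) carries no `2 < e` hypothesis while R3 and R3anc do, the exact statement uses the
RESTRICTION of R3var to `2 < e` — verbatim the conclusion of gen 1's `weilVariationalHodgeCMField_of_weilClassesCMField_of_lt`.
This file proves `R3 → R3anc` (constant family over `Spec ℂ`, as `anchoredWeilFamiliesCMField_of_hodgeConjecture` with HC
replaced by R3), re-proves the glue from the restricted transport leaf, and records the equivalence
`WeilClassesCMField ↔ AnchoredWeilFamiliesCMField ∧ R3var|_{e>2}`. Sorry-free; no definition. Serves stmt-HodgeConjecture-1259.
-/

-- every declaration of this problem lives in `Summit.HodgeConjecture.HodgeConjecture.…` (summit = sub-problem)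
set_option linter.dupNamespace false

noncomputable section

open CategoryTheory AlgebraicGeometry

namespace Summit.HodgeConjecture.HodgeConjecture.WeilTypeLadder

open Literature.AlgebraicGeometry Literature.AlgebraicGeometry.Motives
open Literature.AlgebraicGeometry.HodgeTheory
open Literature.AlgebraicTopology.SingularHomology
open Summit.HodgeConjecture.HodgeConjecture.Theorems

/-- **R3var restricted to CM fields of degree `e > 2`** — the conclusion of gen 1's
`weilVariationalHodgeCMField_of_weilClassesCMField_of_lt`, as a standalone statement (definitional abbreviation NOT
introduced: written out so that no new `def` enters `Theorems/`). [folklore] -/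
theorem weilVariationalHodgeCMField_restrict (hV : WeilVariationalHodgeCMField) :
    ∀ (P : Polynomial ℤ) (e m : ℕ), P.Monic → P.natDegree = e → 2 < e →
      Irreducible (P.map (Int.castRingHom ℚ)) →
      (∀ ρ : ℂ, Polynomial.eval₂ (Int.castRingHom ℂ) ρ P = 0 → starRingEnd ℂ ρ ≠ ρ) →
      (∃ Q : Polynomial ℚ, ∀ ρ : ℂ, Polynomial.eval₂ (Int.castRingHom ℂ) ρ P = 0 →
          Polynomial.eval₂ (algebraMap ℚ ℂ) ρ Q = starRingEnd ℂ ρ) →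
      1 ≤ m →
      ∀ ⦃𝒳 S : Motives.SchemeOver ℂ⦄ (f : 𝒳 ⟶ S), Motives.IsSmoothProjectiveFamily f (e * m) →
        IsQuasiProjectiveOver 𝒳 → IsQuasiProjectiveOver S → IrreducibleSpace S.left →
        AlgebraicGeometry.Smooth S.hom →
        ∀ (W : complexBetti 𝒳 (2 * m)),
          (∀ s : Motives.ComplexPoints S,
            IsRationalClass (complexBetti.map (Motives.fiberι f s) (2 * m) W) ∧
              IsOfHodgeType (e * m) (Motives.fiberOver f s) (2 * m) m m
                (complexBetti.map (Motives.fiberι f s) (2 * m) W)) →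
          (∀ s : Motives.ComplexPoints S, ∃ (A' : Motives.AbelianVariety ℂ) (φ' : A' ⟶ A')
              (e' : A'.X ≅ Motives.fiberOver f s),
            Polynomial.eval₂ (Int.castRingHom (CategoryTheory.End A')) (φ' : CategoryTheory.End A') P = 0 ∧
              e * (2 * m) = 2 * A'.dim ∧
              complexBetti.map e'.hom (2 * m) (complexBetti.map (Motives.fiberι f s) (2 * m) W) ∈
                weilClassesField A' φ' P (2 * m)) →
          (∃ s₀ : Motives.ComplexPoints S,
            complexBetti.map (Motives.fiberι f s₀) (2 * m) W ∈
              algebraicClasses (Motives.fiberOver f s₀) m) →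
          ∀ s : Motives.ComplexPoints S,
            complexBetti.map (Motives.fiberι f s) (2 * m) W ∈
              algebraicClasses (Motives.fiberOver f s) m :=
  fun P e m hP hPe _ hirr hnr hQ hm _ _ f hf h𝒳 hS hirrS hsm W hW hWeil hs₀ s ↦
    hV P e m hP hPe hirr hnr hQ hm f hf h𝒳 hS hirrS hsm W hW hWeil hs₀ s

/-- **R3 ⟹ R3anc**: the constant family `A.X ⟶ Spec ℂ` anchored at `A` itself (`c` algebraic by R3) — the
construction of `anchoredWeilFamiliesCMField_of_hodgeConjecture` verbatim, with the Hodge conjecture replaced by R3.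
[folklore] -/
theorem anchoredWeilFamiliesCMField_of_weilClassesCMField (h : WeilClassesCMField) : AnchoredWeilFamiliesCMField := by
  intro A φ P e m hP hPe he hirrP hφ hdim hnr hQ c hc hcQ hcH _
  have hA : IsSmoothProjective A.dim A.X := AbelianVariety.isSmoothProjective_holds (A := A)
  have hA'dim : A.dim = e * m := by
    have h2 : e * (2 * m) = 2 * (e * m) := by ring
    omega
  have hX : IsSmoothProjective (e * m) A.X := hA'dim ▸ hA
  have hfam : IsSmoothProjectiveFamily (toSpecOver A.X) (e * m) := isSmoothProjectiveFamily_toSpecOver' hX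
  let s : ComplexPoints (specOver ℂ ℂ) := 𝟙 (specOver ℂ ℂ)
  haveI : ∀ t : ComplexPoints (specOver ℂ ℂ), IsIso (fiberι (toSpecOver A.X) t) :=
    fun t => isIso_fiberι_toSpecOver' (X := A.X) t
  let ι : A.X ≅ fiberOver (toSpecOver A.X) s := (asIso (fiberι (toSpecOver A.X) s)).symm
  have halg : c ∈ algebraicClasses A.X m := h A φ P e m hP hPe he hirrP hφ hdim hnr hQ c hc hcQ hcH
  have hback : ∀ t : ComplexPoints (specOver ℂ ℂ),
      complexBetti.map (asIso (fiberι (toSpecOver A.X) t)).symm.hom (2 * m)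
        (complexBetti.map (fiberι (toSpecOver A.X) t) (2 * m) c) = c := fun t => by
    change (complexBetti.map (asIso (fiberι (toSpecOver A.X) t)).hom (2 * m) ≫
      complexBetti.map (asIso (fiberι (toSpecOver A.X) t)).inv (2 * m)) c = c
    rw [← complexBetti.map_comp, Iso.inv_hom_id, complexBetti.map_id]
    rfl
  refine ⟨A.X, specOver ℂ ℂ, toSpecOver A.X, s, s, ι, c, hfam,
    IsQuasiProjectiveOver.of_isProjectiveOver hA.isProjectiveOver, IsQuasiProjectiveOver.specOver,
    inferInstanceAs (IrreducibleSpace (PrimeSpectrum ℂ)), ?_, ?_, ?_, hback s, ?_⟩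
  · haveI : IsIso (specOver ℂ ℂ).hom := by rw [specOver_hom_eq_id]; exact IsIso.id _
    infer_instance
  · intro t
    exact ⟨hcQ.pullback _, IsOfHodgeType.map_of_iso (asIso (fiberι (toSpecOver A.X) t)) (hA'dim ▸ hcH)⟩
  · intro t
    refine ⟨A, φ, (asIso (fiberι (toSpecOver A.X) t)).symm, hφ, hdim, ?_⟩
    rw [hback t]
    exact hc
  · exact (mem_algebraicClasses_map_iff_of_iso (asIso (fiberι (toSpecOver A.X) s))).2 halg

/-- **Glue from the RESTRICTED transport leaf**: `R3anc ∧ R3var|_{e>2} → R3` (gen 1's glue needs R3var only at the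
degree `e > 2` of the class in hand, so the restriction suffices; proof verbatim otherwise).
[cite: Markman2025SecantRealMultiplication, Thm. 1.1.2 and Cor. 11.2.4] -/
theorem weilClassesCMField_of_anchored_of_variational_restrict (hA : AnchoredWeilFamiliesCMField)
    (hV : ∀ (P : Polynomial ℤ) (e m : ℕ), P.Monic → P.natDegree = e → 2 < e →
      Irreducible (P.map (Int.castRingHom ℚ)) →
      (∀ ρ : ℂ, Polynomial.eval₂ (Int.castRingHom ℂ) ρ P = 0 → starRingEnd ℂ ρ ≠ ρ) →
      (∃ Q : Polynomial ℚ, ∀ ρ : ℂ, Polynomial.eval₂ (Int.castRingHom ℂ) ρ P = 0 →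
          Polynomial.eval₂ (algebraMap ℚ ℂ) ρ Q = starRingEnd ℂ ρ) →
      1 ≤ m →
      ∀ ⦃𝒳 S : Motives.SchemeOver ℂ⦄ (f : 𝒳 ⟶ S), Motives.IsSmoothProjectiveFamily f (e * m) →
        IsQuasiProjectiveOver 𝒳 → IsQuasiProjectiveOver S → IrreducibleSpace S.left →
        AlgebraicGeometry.Smooth S.hom →
        ∀ (W : complexBetti 𝒳 (2 * m)),
          (∀ s : Motives.ComplexPoints S,
            IsRationalClass (complexBetti.map (Motives.fiberι f s) (2 * m) W) ∧
              IsOfHodgeType (e * m) (Motives.fiberOver f s) (2 * m) m m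
                (complexBetti.map (Motives.fiberι f s) (2 * m) W)) →
          (∀ s : Motives.ComplexPoints S, ∃ (A' : Motives.AbelianVariety ℂ) (φ' : A' ⟶ A')
              (e' : A'.X ≅ Motives.fiberOver f s),
            Polynomial.eval₂ (Int.castRingHom (CategoryTheory.End A')) (φ' : CategoryTheory.End A') P = 0 ∧
              e * (2 * m) = 2 * A'.dim ∧
              complexBetti.map e'.hom (2 * m) (complexBetti.map (Motives.fiberι f s) (2 * m) W) ∈
                weilClassesField A' φ' P (2 * m)) →
          (∃ s₀ : Motives.ComplexPoints S,
            complexBetti.map (Motives.fiberι f s₀) (2 * m) W ∈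
              algebraicClasses (Motives.fiberOver f s₀) m) →
          ∀ s : Motives.ComplexPoints S,
            complexBetti.map (Motives.fiberι f s) (2 * m) W ∈
              algebraicClasses (Motives.fiberOver f s) m) :
    WeilClassesCMField := by
  intro A φ P e m hP hPe he hirr hφ hdim hnr hQ c hc hcQ hcH
  by_cases hc0 : c = 0
  · rw [hc0]; exact Submodule.zero_mem _
  rcases Nat.eq_zero_or_pos m with hm0 | hm
  · subst hm0
    rw [algebraicClasses_zero]
    exact Submodule.mem_top
  obtain ⟨𝒳, S, f, s₁, s₀, ι, W, hf, h𝒳, hS, hirrS, hsm, hW, hWeil, hread, hs₀⟩ :=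
    hA A φ P e m hP hPe he hirr hφ hdim hnr hQ c hc hcQ hcH hc0
  haveI := hirrS
  have h1 : complexBetti.map (fiberι f s₁) (2 * m) W ∈ algebraicClasses (fiberOver f s₁) m :=
    hV P e m hP hPe he hirr hnr hQ hm f hf h𝒳 hS hirrS hsm W hW hWeil ⟨s₀, hs₀⟩ s₁
  rw [← hread]
  exact (mem_algebraicClasses_map_iff_of_iso ι).2 h1

/-- **EXACTNESS of the CM-field decomposition: `R3 ⟺ R3anc ∧ R3var|_{e>2}`.** The CM rung `WeilClassesCMField` is
EQUIVALENT to anchor supply together with the transport leaf at degrees `e > 2` (`→`: the constant family and gen 1's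
`weilVariationalHodgeCMField_of_weilClassesCMField_of_lt`; `←`: the glue from the restricted leaf). With the unrestricted
leaf one has `R3anc ∧ R3var → R3` (gen 1) and `R3 → R3anc`, `R3var → R3var|_{e>2}` (`weilVariationalHodgeCMField_restrict`).
[cite: Markman2025SecantRealMultiplication, Cor. 11.2.4] [folklore] -/
theorem weilClassesCMField_iff_anchored_and_variational_restrict :
    WeilClassesCMField ↔ (AnchoredWeilFamiliesCMField ∧
      ∀ (P : Polynomial ℤ) (e m : ℕ), P.Monic → P.natDegree = e → 2 < e →
        Irreducible (P.map (Int.castRingHom ℚ)) →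
        (∀ ρ : ℂ, Polynomial.eval₂ (Int.castRingHom ℂ) ρ P = 0 → starRingEnd ℂ ρ ≠ ρ) →
        (∃ Q : Polynomial ℚ, ∀ ρ : ℂ, Polynomial.eval₂ (Int.castRingHom ℂ) ρ P = 0 →
            Polynomial.eval₂ (algebraMap ℚ ℂ) ρ Q = starRingEnd ℂ ρ) →
        1 ≤ m →
        ∀ ⦃𝒳 S : Motives.SchemeOver ℂ⦄ (f : 𝒳 ⟶ S), Motives.IsSmoothProjectiveFamily f (e * m) →
          IsQuasiProjectiveOver 𝒳 → IsQuasiProjectiveOver S → IrreducibleSpace S.left →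
          AlgebraicGeometry.Smooth S.hom →
          ∀ (W : complexBetti 𝒳 (2 * m)),
            (∀ s : Motives.ComplexPoints S,
              IsRationalClass (complexBetti.map (Motives.fiberι f s) (2 * m) W) ∧
                IsOfHodgeType (e * m) (Motives.fiberOver f s) (2 * m) m m
                  (complexBetti.map (Motives.fiberι f s) (2 * m) W)) →
            (∀ s : Motives.ComplexPoints S, ∃ (A' : Motives.AbelianVariety ℂ) (φ' : A' ⟶ A')
                (e' : A'.X ≅ Motives.fiberOver f s),
              Polynomial.eval₂ (Int.castRingHom (CategoryTheory.End A')) (φ' : CategoryTheory.End A') P = 0 ∧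
                e * (2 * m) = 2 * A'.dim ∧
                complexBetti.map e'.hom (2 * m) (complexBetti.map (Motives.fiberι f s) (2 * m) W) ∈
                  weilClassesField A' φ' P (2 * m)) →
            (∃ s₀ : Motives.ComplexPoints S,
              complexBetti.map (Motives.fiberι f s₀) (2 * m) W ∈
                algebraicClasses (Motives.fiberOver f s₀) m) →
            ∀ s : Motives.ComplexPoints S,
              complexBetti.map (Motives.fiberι f s) (2 * m) W ∈
                algebraicClasses (Motives.fiberOver f s) m) :=
  ⟨fun h ↦ ⟨anchoredWeilFamiliesCMField_of_weilClassesCMField h,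
      weilVariationalHodgeCMField_of_weilClassesCMField_of_lt h⟩,
    fun h ↦ weilClassesCMField_of_anchored_of_variational_restrict h.1 h.2⟩

end Summit.HodgeConjecture.HodgeConjecture.WeilTypeLadder

end
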